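import Literature.MathematicalPhysics.QuantumManyBody.PeriodicHardCoreCutoffState
import Literature.MathematicalPhysics.QuantumManyBody.PeriodicHardCoreTrialEnergy
import Literature.MathematicalPhysics.QuantumManyBody.PeriodicHardCoreTrialProduct
import Literature.MathematicalPhysics.QuantumManyBody.PeriodicMaxFormApproximation
import HarnessLib

/-!
# The maximal-form bound for the periodic Bose gas with a hard core

`Literature/MathematicalPhysics/QuantumManyBody` support file (everything proved; no definitions, no
named facts), namespace `Literature.MathematicalPhysics.QuantumManyBody.BoseGas`; states in
`L²((ℝ/ℤ)^{N×3}, μ_H)` (`= L2T N` of `PeriodicFormDomain`). **Theorem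
(`periodicGroundStateEnergy_le_maxForm_of_hardCore`).** Let the pair profile `v` have a hard core of
radius `a > 0` (`v = +∞` on `[0, a]`) and agree beyond it with an admissible tail `v'`
(`v = v'` on `(a, ∞)`, `v' ≤ v`, `v'` measurable with `∫_{cell} W_{v'} < ∞`), in a box of side
`L > 2a`, and let `E₀ = periodicGroundStateEnergy v N L < ∞`. Then for every normalised
Bose-symmetric `η ∈ L²((ℝ/ℤ)^{N×3})`,

  `E₀ ≤ maxFormKin L η + maxFormPot v L η`,

i.e. the ground-state energy over `C¹` periodic symmetric trial states is bounded by the maximal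
(Friedrichs) form although `W_v` is not locally integrable (`periodicGroundStateEnergy_le_maxForm`
of `PeriodicMaxFormBound` needs `∫_{cell} W < ∞`). The unfolded form with the explicit series and
integral is `periodicGroundStateEnergy_le_tsum_add_lintegral_of_hardCore`; the tail `v' = v 𝟙_{(a,∞)}`
is spelled out in `periodicGroundStateEnergy_le_maxForm_of_hardCore_tail`.

**Proof.** For `ε > 0`: cut `η` off the tubes (`ζ = χ_δ η`, `PeriodicHardCoreCutoffState`: kinetic
cost `≤ ε`, by the tube Hardy inequality and absolute continuity on lines), approximate `ζ` by a
Bose-symmetric trigonometric polynomial `P` in the maximal form of the *tail* `v'`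
(`exists_symm_trigPoly_maxForm_approx_general`), multiply by the smooth cut-off `χ̃` at scale `δ/4`
(`PeriodicHardCoreTrialProduct`: `χ̃ P` is the embedded class of a core function, so the core
variational principle `periodicGroundStateEnergy_mul_le_maxForm_core` — whose physical profile is
arbitrary — applies with the hard-core `v`), and control the three terms by
`PeriodicHardCoreTrialEnergy`: the hard core is invisible on the support of `χ̃`, the Leibniz error
lives on collars where `ζ = 0` and is `O(‖P - ζ‖²/δ²)`, and `‖χ̃P - ζ‖ ≤ ‖P - ζ‖`. This gives
`E₀ (1 - 2ε)² ≤ (1+ε)((1+ε)T + c₁ε) + ε + (P_v + ε)` (`hardCore_energy_bound_eps`), and `ε → 0`.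

## Mathlib / tree search

Tree: `exists_hardCore_cutoffState`, `exists_symm_trigPoly_maxForm_approx_general`,
`exists_core_formEmbed_eq_sum_smul`, `exists_core_coeFn_eq_pairCutoff_mul`,
`periodicGroundStateEnergy_mul_le_maxForm_core`, `maxFormPot_le_of_coeFn_eq_pairCutoff_mul`,
`maxFormKin_le_of_coeFn_eq_pairCutoff_mul`, `norm_sub_le_of_coeFn_eq_pairCutoff_mul`.

## References

* E. H. Lieb, R. Seiringer, J. P. Solovej, J. Yngvason, *The Mathematics of the Bose Gas and its
  Condensation*, Birkhäuser (2005), Ch. 2 and App. A.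
* B. Simon, *Maximal and minimal Schrödinger forms*, J. Operator Theory 1 (1979) 37–47.
-/

noncomputable section

open MeasureTheory Filter Set Complex UnitAddTorus
open scoped ENNReal NNReal Topology InnerProductSpace
open Literature.Analysis.FunctionSpaces

namespace Literature.MathematicalPhysics.QuantumManyBody.BoseGas

variable {N : ℕ} {L : ℝ} {v : ℝ → ℝ≥0∞}

/-- Local notation for `L²((ℝ/ℤ)^{3N}, μ_H)` (the `L2T N` of `PeriodicFormDomain.lean`). -/
local notation "L2H " N':max =>
  Lp ℂ 2 (Measure.pi fun _ : Fin N' × Fin 3 => (AddCircle.haarAddCircle : Measure UnitAddCircle))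

/-! ## The `ε → 0` bookkeeping -/

/-- Real-variable limit: if `e (1 - 2ε)² ≤ (1+ε)((1+ε)t + cε) + ε + (p + ε)` for all small `ε > 0`
(`e, t, p, c ≥ 0`), then `e ≤ t + p`. [folklore] -/
theorem le_add_of_forall_eps_bound {e t p c : ℝ} (he : 0 ≤ e) (ht : 0 ≤ t) (hc : 0 ≤ c)
    (h : ∀ ε : ℝ, 0 < ε → ε < 1 / 8 → e * (1 - 2 * ε) ^ 2 ≤ (1 + ε) * ((1 + ε) * t + c * ε) + ε + (p + ε)) :
    e ≤ t + p := by
  refine le_of_forall_pos_le_add fun η hη => ?_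
  set M : ℝ := 3 * t + 2 * c + 2 + 4 * e + 1 with hM
  have hM0 : 0 < M := by rw [hM]; positivity
  set ε : ℝ := min (1 / 16) (η / M) with hεdef
  have hε0 : 0 < ε := lt_min (by norm_num) (div_pos hη hM0)
  have hε1 : ε ≤ 1 / 16 := min_le_left _ _
  have hε2 : ε * M ≤ η := by
    have : ε ≤ η / M := min_le_right _ _
    rwa [le_div_iff₀ hM0] at this
  have hb := h ε hε0 (by linarith)
  -- `e (1-2ε)² ≥ e - 4εe` and `RHS ≤ t + p + ε (3t + 2c + 2)`
  have h1 : e - 4 * ε * e ≤ e * (1 - 2 * ε) ^ 2 := by nlinarith [sq_nonneg ε]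
  have h2 : (1 + ε) * ((1 + ε) * t + c * ε) + ε + (p + ε) ≤ t + p + ε * (3 * t + 2 * c + 2) := by
    nlinarith [mul_nonneg ht hε0.le, mul_nonneg hc hε0.le]
  have h3 : e ≤ t + p + ε * M := by rw [hM]; nlinarith
  linarith

/-! ## The bound at fixed `ε` -/

/-- **The hard-core energy bound at fixed `ε`.** Under the hypotheses of
`periodicGroundStateEnergy_le_maxForm_of_hardCore`, for `0 < ε < 1/8`:
`E₀ · (1 - 2ε)² ≤ (1+ε)((1+ε) maxFormKin η + (2π/L)² |Fin N × Fin 3| ε) + ε + (maxFormPot v η + ε)`.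
[folklore] -/
theorem hardCore_energy_bound_eps (hL : 0 < L) (hvm : Measurable v) {a : ℝ} (ha : 0 < a) (haL : a / L < 1 / 2)
    (hcore : ∀ ρ : ℝ, 0 ≤ ρ → ρ ≤ a → v ρ = ⊤) {v' : ℝ → ℝ≥0∞} (hv'm : Measurable v')
    (hvv' : ∀ ρ : ℝ, a < ρ → v ρ = v' ρ) (hle : ∀ ρ : ℝ, v' ρ ≤ v ρ)
    (hW' : ∫⁻ X in cellN N L, periodicInteraction v' L X ≠ ⊤)
    {η : L2H N} (hη1 : ‖η‖ = 1) (hηs : η ∈ boseSymmetric N)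
    (hT : maxFormKin L η ≠ ⊤) (hP : maxFormPot v L η ≠ ⊤) {ε : ℝ} (hε : 0 < ε) (hε1 : ε < 1 / 8) :
    periodicGroundStateEnergy v N L * ENNReal.ofReal ((1 - 2 * ε) ^ 2) ≤
      ENNReal.ofReal (1 + ε) * (ENNReal.ofReal (1 + ε) * maxFormKin L η +
        ENNReal.ofReal ((2 * Real.pi / L) ^ 2) * ((Fintype.card (Fin N × Fin 3) : ℝ≥0∞) * ENNReal.ofReal ε)) +
        ENNReal.ofReal ε + (maxFormPot v L η + ENNReal.ofReal ε) := by
  have hr0 : 0 < a / L := div_pos ha hL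
  have hδ₀ : 0 < 1 - 2 * (a / L) := by linarith
  -- Step 1: the cut-off state at accuracy `ε²`
  obtain ⟨δ, hδ0, hδ1, ζ, hζae, hζs, hζT, hζP, hζn⟩ :=
    exists_hardCore_cutoffState hL hvm ha hcore hηs hT hP (ε := ε ^ 2) (by positivity) hδ₀
  have hζn' : ‖ζ - η‖ ≤ ε := (pow_le_pow_iff_left₀ (norm_nonneg _) hε.le two_ne_zero).1 hζn
  have hε2 : ε ^ 2 ≤ ε := by nlinarith
  have hζT' : maxFormKin L ζ ≤ ENNReal.ofReal (1 + ε) * maxFormKin L η +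
      ENNReal.ofReal ((2 * Real.pi / L) ^ 2) * ((Fintype.card (Fin N × Fin 3) : ℝ≥0∞) * ENNReal.ofReal ε) := by
    refine hζT.trans ?_
    gcongr
  -- Step 2: the smooth cut-off at scale `δ' = δ/4`
  set δ' : ℝ := δ / 4 with hδ'
  have hδ'0 : 0 < δ' := by positivity
  have h2' : a / L + 2 * δ' < 1 / 2 := by rw [hδ']; linarith
  have h52 : 5 * δ' / 2 ≤ δ := by rw [hδ']; linarith
  have h22 : 2 * δ' ≤ δ := by rw [hδ']; linarith
  obtain ⟨K, hK⟩ := Torus.exists_isCutProfile_smoothCutProfile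
  -- the constant of the Leibniz error, as a multiple of the collar bound
  set Cst : ℝ≥0∞ := ENNReal.ofReal ((2 * Real.pi / L) ^ 2) * ((Fintype.card (Fin N × Fin 3) : ℝ≥0∞) *
    (ENNReal.ofReal (1 + ε⁻¹) * ENNReal.ofReal (1 / (2 * Real.pi) ^ 2) *
      ((N : ℝ≥0∞) * (ENNReal.ofReal (25 * (K : ℝ) ^ 2) * ((N : ℝ≥0∞) * ENNReal.ofReal (4 / δ' ^ 2)))))) with hCst
  have hCst_top : Cst ≠ ⊤ := by
    rw [hCst]
    refine ENNReal.mul_ne_top ENNReal.ofReal_ne_top (ENNReal.mul_ne_top (ENNReal.natCast_ne_top _) ?_)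
    refine ENNReal.mul_ne_top (ENNReal.mul_ne_top ENNReal.ofReal_ne_top ENNReal.ofReal_ne_top) ?_
    refine ENNReal.mul_ne_top (ENNReal.natCast_ne_top _) (ENNReal.mul_ne_top ENNReal.ofReal_ne_top ?_)
    exact ENNReal.mul_ne_top (ENNReal.natCast_ne_top _) ENNReal.ofReal_ne_top
  set cR : ℝ := Cst.toReal with hcR
  have hcR0 : 0 ≤ cR := ENNReal.toReal_nonneg
  -- Step 3: the accuracy of the trigonometric approximation
  set εm : ℝ := ε / (cR + 1) with hεm
  have hεm0 : 0 < εm := div_pos hε (by linarith)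
  have hεm1 : εm ≤ ε := by
    rw [hεm, div_le_iff₀ (by linarith)]
    nlinarith
  have hεm2 : cR * εm ^ 2 ≤ ε := by
    have h1 : cR * εm ^ 2 ≤ (cR + 1) * εm ^ 2 := by nlinarith [sq_nonneg εm]
    have h2 : (cR + 1) * εm ^ 2 = ε * εm := by
      rw [hεm]; field_simp
    nlinarith [h1, h2, hεm1, hε.le, hεm0.le]
  -- Step 4: the Bose-symmetric trigonometric polynomial `P` approximating `ζ` for the tail `v'`
  obtain ⟨S, aC, hS, haC, hPk, hPp, hPn⟩ :=
    exists_symm_trigPoly_maxForm_approx_general hL hv'm hW' ζ (mem_boseSymmetric.1 hζs) hεm0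
  set P : L2H N := ∑ m ∈ S, aC m • (mFourierLp 2 m : L2H N) with hPdef
  have hPk' : maxFormKin L P ≤ maxFormKin L ζ := hPk
  have hPp' : maxFormPot v' L P ≤ maxFormPot v' L ζ + ENNReal.ofReal εm := hPp
  -- Step 5: the core function `χ̃ · P` and the core variational principle with the hard-core `v`
  obtain ⟨Ψ, hΨ⟩ := exists_core_formEmbed_eq_sum_smul hL hv'm hW' hS haC
  obtain ⟨Φc, hΦ⟩ := exists_core_coeFn_eq_pairCutoff_mul hL hv'm hW' Ψ hδ'0 hr0.le h2'
  rw [hΨ] at hΦ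
  set F : L2H N := formEmbed hL hv'm hW' ⟨graphEmbed hL hv'm hW' Φc, graphEmbed_mem_formDomain hL hv'm hW' Φc⟩ with hFdef
  have hFae : (F : UnitAddTorus (Fin N × Fin 3) → ℂ) =ᵐ[volume]
      fun t => (Torus.pairCutoff Torus.smoothCutProfile (a / L) δ' t : ℂ) * (P : UnitAddTorus (Fin N × Fin 3) → ℂ) t :=
    ae_global_of_ae_haar hΦ
  have hvar : periodicGroundStateEnergy v N L * ENNReal.ofReal (‖F‖ ^ 2) ≤ maxFormKin L F + maxFormPot v L F :=
    periodicGroundStateEnergy_mul_le_maxForm_core hL hv'm hW' hvm Φc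
  -- Step 6: the three estimates
  have hFP : maxFormPot v L F ≤ maxFormPot v' L P :=
    maxFormPot_le_of_coeFn_eq_pairCutoff_mul hL hvv' hK hδ'0 hFae
  have hB : ∀ i j : Fin N, i ≠ j →
      ∫⁻ t in {t | a / L + δ' / 2 < Torus.pairDist i j t ∧ Torus.pairDist i j t < a / L + 5 * δ' / 2},
        ‖(P : UnitAddTorus (Fin N × Fin 3) → ℂ) t‖ₑ ^ 2 / ENNReal.ofReal ((Torus.pairDist i j t - a / L) ^ 2) ≤
      ENNReal.ofReal (4 / δ' ^ 2) * ENNReal.ofReal (‖P - ζ‖ ^ 2) := fun i j hij =>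
    collar_lintegral_le_norm_sub_sq Torus.isCutProfile_cutProfile hδ0 hδ'0 h52 hij hζae
  have hFK := maxFormKin_le_of_coeFn_eq_pairCutoff_mul (L := L) hK hr0 hδ'0 hFae hB hε
  -- the Leibniz error is at most `ε`
  have herr : ENNReal.ofReal ((2 * Real.pi / L) ^ 2) * ((Fintype.card (Fin N × Fin 3) : ℝ≥0∞) *
      (ENNReal.ofReal (1 + ε⁻¹) * ENNReal.ofReal (1 / (2 * Real.pi) ^ 2) *
        ((N : ℝ≥0∞) * (ENNReal.ofReal (25 * (K : ℝ) ^ 2) * ((N : ℝ≥0∞) *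
          (ENNReal.ofReal (4 / δ' ^ 2) * ENNReal.ofReal (‖P - ζ‖ ^ 2))))))) ≤ ENNReal.ofReal ε := by
    have hfac : ENNReal.ofReal ((2 * Real.pi / L) ^ 2) * ((Fintype.card (Fin N × Fin 3) : ℝ≥0∞) *
        (ENNReal.ofReal (1 + ε⁻¹) * ENNReal.ofReal (1 / (2 * Real.pi) ^ 2) *
          ((N : ℝ≥0∞) * (ENNReal.ofReal (25 * (K : ℝ) ^ 2) * ((N : ℝ≥0∞) *
            (ENNReal.ofReal (4 / δ' ^ 2) * ENNReal.ofReal (‖P - ζ‖ ^ 2))))))) =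
        Cst * ENNReal.ofReal (‖P - ζ‖ ^ 2) := by
      rw [hCst]; ring
    rw [hfac, ← ENNReal.ofReal_toReal hCst_top, ← hcR, ← ENNReal.ofReal_mul hcR0]
    refine ENNReal.ofReal_le_ofReal (le_trans ?_ hεm2)
    exact mul_le_mul_of_nonneg_left (pow_le_pow_left₀ (norm_nonneg _) hPn 2) hcR0
  have hFK' : maxFormKin L F ≤ ENNReal.ofReal (1 + ε) * maxFormKin L ζ + ENNReal.ofReal ε :=
    hFK.trans (add_le_add (mul_le_mul_right hPk' _) herr)
  -- the mass
  have hFn : ‖F - ζ‖ ≤ εm :=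
    (norm_sub_le_of_coeFn_eq_pairCutoff_mul Torus.isCutProfile_cutProfile hK hδ0 hδ'0 h22 hFae hζae).trans hPn
  have hFnorm : 1 - 2 * ε ≤ ‖F‖ := by
    have h1 : ‖η‖ ≤ ‖F‖ + ‖F - ζ‖ + ‖ζ - η‖ := by
      calc ‖η‖ = ‖F - ((F - ζ) + (ζ - η))‖ := by congr 1; abel
        _ ≤ ‖F‖ + ‖(F - ζ) + (ζ - η)‖ := norm_sub_le _ _
        _ ≤ ‖F‖ + (‖F - ζ‖ + ‖ζ - η‖) := by gcongr; exact norm_add_le _ _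
        _ = _ := by ring
    linarith
  have hsq : (1 - 2 * ε) ^ 2 ≤ ‖F‖ ^ 2 := pow_le_pow_left₀ (by linarith) hFnorm 2
  -- Step 7: assemble
  calc periodicGroundStateEnergy v N L * ENNReal.ofReal ((1 - 2 * ε) ^ 2)
      ≤ periodicGroundStateEnergy v N L * ENNReal.ofReal (‖F‖ ^ 2) :=
        mul_le_mul_right (ENNReal.ofReal_le_ofReal hsq) _
    _ ≤ maxFormKin L F + maxFormPot v L F := hvar
    _ ≤ (ENNReal.ofReal (1 + ε) * maxFormKin L ζ + ENNReal.ofReal ε) + (maxFormPot v' L ζ + ENNReal.ofReal εm) :=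
        add_le_add hFK' (hFP.trans hPp')
    _ ≤ _ := by
        gcongr
        exact (hζP v').trans (maxFormPot_mono_profile hle L η)

/-! ## The theorem -/

/-- **The maximal-form bound for the hard-core Bose gas.** Let `v = +∞` on `[0, a]` (`0 < a`,
`a/L < 1/2`), `v = v'` on `(a, ∞)` with `v' ≤ v` measurable and `∫_{cell} W_{v'} < ∞`, `0 < L`,
`E₀ = periodicGroundStateEnergy v N L < ∞`. Then every normalised Bose-symmetric
`η ∈ L²((ℝ/ℤ)^{N×3})` satisfies `E₀ ≤ maxFormKin L η + maxFormPot v L η`. [folklore] -/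
theorem periodicGroundStateEnergy_le_maxForm_of_hardCore (hL : 0 < L) (hvm : Measurable v) {a : ℝ} (ha : 0 < a)
    (haL : a / L < 1 / 2) (hcore : ∀ ρ : ℝ, 0 ≤ ρ → ρ ≤ a → v ρ = ⊤) {v' : ℝ → ℝ≥0∞} (hv'm : Measurable v')
    (hvv' : ∀ ρ : ℝ, a < ρ → v ρ = v' ρ) (hle : ∀ ρ : ℝ, v' ρ ≤ v ρ)
    (hW' : ∫⁻ X in cellN N L, periodicInteraction v' L X ≠ ⊤)
    (hE : periodicGroundStateEnergy v N L ≠ ⊤) (η : L2H N) (hη1 : ‖η‖ = 1) (hηs : η ∈ boseSymmetric N) :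
    periodicGroundStateEnergy v N L ≤ maxFormKin L η + maxFormPot v L η := by
  by_cases hT : maxFormKin L η = ⊤
  · rw [hT, top_add]; exact le_top
  by_cases hP : maxFormPot v L η = ⊤
  · rw [hP, add_top]; exact le_top
  set c₁ : ℝ≥0∞ := ENNReal.ofReal ((2 * Real.pi / L) ^ 2) * (Fintype.card (Fin N × Fin 3) : ℝ≥0∞) with hc₁
  have hc₁top : c₁ ≠ ⊤ := ENNReal.mul_ne_top ENNReal.ofReal_ne_top (ENNReal.natCast_ne_top _)
  -- pass to real numbers
  have hreal : ∀ ε : ℝ, 0 < ε → ε < 1 / 8 →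
      (periodicGroundStateEnergy v N L).toReal * (1 - 2 * ε) ^ 2 ≤
        (1 + ε) * ((1 + ε) * (maxFormKin L η).toReal + c₁.toReal * ε) + ε + ((maxFormPot v L η).toReal + ε) := by
    intro ε hε hε1
    have h := hardCore_energy_bound_eps hL hvm ha haL hcore hv'm hvv' hle hW' hη1 hηs hT hP hε hε1
    have hc : ENNReal.ofReal ((2 * Real.pi / L) ^ 2) * ((Fintype.card (Fin N × Fin 3) : ℝ≥0∞) * ENNReal.ofReal ε) =
        c₁ * ENNReal.ofReal ε := by rw [hc₁, mul_assoc]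
    rw [hc] at h
    have hfin : ENNReal.ofReal (1 + ε) * (ENNReal.ofReal (1 + ε) * maxFormKin L η + c₁ * ENNReal.ofReal ε) +
        ENNReal.ofReal ε + (maxFormPot v L η + ENNReal.ofReal ε) ≠ ⊤ := by
      refine ENNReal.add_ne_top.2 ⟨ENNReal.add_ne_top.2 ⟨?_, ENNReal.ofReal_ne_top⟩,
        ENNReal.add_ne_top.2 ⟨hP, ENNReal.ofReal_ne_top⟩⟩
      exact ENNReal.mul_ne_top ENNReal.ofReal_ne_top (ENNReal.add_ne_top.2
        ⟨ENNReal.mul_ne_top ENNReal.ofReal_ne_top hT, ENNReal.mul_ne_top hc₁top ENNReal.ofReal_ne_top⟩)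
    have h' := ENNReal.toReal_mono hfin h
    rw [ENNReal.toReal_mul, ENNReal.toReal_ofReal (sq_nonneg _)] at h'
    rw [ENNReal.toReal_add (by
        refine ENNReal.add_ne_top.2 ⟨?_, ENNReal.ofReal_ne_top⟩
        exact ENNReal.mul_ne_top ENNReal.ofReal_ne_top (ENNReal.add_ne_top.2
          ⟨ENNReal.mul_ne_top ENNReal.ofReal_ne_top hT, ENNReal.mul_ne_top hc₁top ENNReal.ofReal_ne_top⟩))
        (ENNReal.add_ne_top.2 ⟨hP, ENNReal.ofReal_ne_top⟩),
      ENNReal.toReal_add (ENNReal.mul_ne_top ENNReal.ofReal_ne_top (ENNReal.add_ne_top.2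
          ⟨ENNReal.mul_ne_top ENNReal.ofReal_ne_top hT, ENNReal.mul_ne_top hc₁top ENNReal.ofReal_ne_top⟩))
        ENNReal.ofReal_ne_top,
      ENNReal.toReal_add hP ENNReal.ofReal_ne_top, ENNReal.toReal_mul,
      ENNReal.toReal_add (ENNReal.mul_ne_top ENNReal.ofReal_ne_top hT) (ENNReal.mul_ne_top hc₁top ENNReal.ofReal_ne_top),
      ENNReal.toReal_mul, ENNReal.toReal_mul, ENNReal.toReal_ofReal (by linarith), ENNReal.toReal_ofReal hε.le] at h'
    exact h'
  have hle' := le_add_of_forall_eps_bound ENNReal.toReal_nonneg ENNReal.toReal_nonneg ENNReal.toReal_nonneg hreal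
  rw [← ENNReal.toReal_add hT hP] at hle'
  exact (ENNReal.toReal_le_toReal hE (ENNReal.add_ne_top.2 ⟨hT, hP⟩)).1 hle'

/-- **Unfolded form** (the shape of the crux stub `MaxFormBoundNonintegrable`, hard-core class): for
`η ∈ L²((ℝ/ℤ)^{N×3})` with `‖η‖ = 1` and Bose-symmetric Fourier coefficients,
`E₀ ≤ ∑ₙ (∑_p (2πn_p/L)²) |⟪eₙ, η⟫|² + ∫ W_v(fromUnitTorusN L t) |η t|² dt`. [folklore] -/
theorem periodicGroundStateEnergy_le_tsum_add_lintegral_of_hardCore (hL : 0 < L) (hvm : Measurable v) {a : ℝ}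
    (ha : 0 < a) (haL : a / L < 1 / 2) (hcore : ∀ ρ : ℝ, 0 ≤ ρ → ρ ≤ a → v ρ = ⊤) {v' : ℝ → ℝ≥0∞}
    (hv'm : Measurable v') (hvv' : ∀ ρ : ℝ, a < ρ → v ρ = v' ρ) (hle : ∀ ρ : ℝ, v' ρ ≤ v ρ)
    (hW' : ∫⁻ X in cellN N L, periodicInteraction v' L X ≠ ⊤)
    (hE : periodicGroundStateEnergy v N L ≠ ⊤) (η : L2H N) (hη1 : ‖η‖ = 1)
    (hsymm : ∀ (σ : Equiv.Perm (Fin N)) (n : Fin N × Fin 3 → ℤ),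
      ⟪(mFourierLp 2 (fun p : Fin N × Fin 3 => n (σ p.1, p.2)) : L2H N), η⟫_ℂ = ⟪(mFourierLp 2 n : L2H N), η⟫_ℂ) :
    periodicGroundStateEnergy v N L ≤
      ∑' n : Fin N × Fin 3 → ℤ, ENNReal.ofReal (∑ p, (2 * Real.pi * (n p : ℝ) / L) ^ 2) *
          ((‖⟪(mFourierLp 2 n : L2H N), η⟫_ℂ‖₊ : ℝ≥0∞)) ^ 2 +
        ∫⁻ t, periodicInteraction v L (fromUnitTorusN L t) *
          ((‖(η : UnitAddTorus (Fin N × Fin 3) → ℂ) t‖₊ : ℝ≥0∞)) ^ 2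
            ∂(Measure.pi fun _ : Fin N × Fin 3 => (AddCircle.haarAddCircle : Measure UnitAddCircle)) :=
  periodicGroundStateEnergy_le_maxForm_of_hardCore hL hvm ha haL hcore hv'm hvv' hle hW' hE η hη1
    (mem_boseSymmetric.2 hsymm)

/-- **Tail form.** The same with the tail taken to be `v' = v · 𝟙_{(a,∞)}`: if `v = +∞` on `[0, a]`
(`0 < a`, `a/L < 1/2`), `v` is measurable, the tail interaction is integrable on the cell,
`∫_{cell} W_{v 𝟙_{(a,∞)}} < ∞`, and `E₀ < ∞`, then `E₀ ≤ maxFormKin L η + maxFormPot v L η` for every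
normalised Bose-symmetric `η`. [folklore] -/
theorem periodicGroundStateEnergy_le_maxForm_of_hardCore_tail (hL : 0 < L) (hvm : Measurable v) {a : ℝ}
    (ha : 0 < a) (haL : a / L < 1 / 2) (hcore : ∀ ρ : ℝ, 0 ≤ ρ → ρ ≤ a → v ρ = ⊤)
    (htail : ∫⁻ X in cellN N L, periodicInteraction (fun ρ => if a < ρ then v ρ else 0) L X ≠ ⊤)
    (hE : periodicGroundStateEnergy v N L ≠ ⊤) (η : L2H N) (hη1 : ‖η‖ = 1) (hηs : η ∈ boseSymmetric N) :
    periodicGroundStateEnergy v N L ≤ maxFormKin L η + maxFormPot v L η := by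
  refine periodicGroundStateEnergy_le_maxForm_of_hardCore hL hvm ha haL hcore (v' := fun ρ => if a < ρ then v ρ else 0)
    (Measurable.ite measurableSet_Ioi hvm measurable_const) (fun ρ hρ => by simp only [if_pos hρ])
    (fun ρ => ?_) htail hE η hη1 hηs
  split_ifs
  · exact le_rfl
  · exact zero_le

end Literature.MathematicalPhysics.QuantumManyBody.BoseGas

end
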